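import Summits.ABC.IUTFork.Joshi.TestGenuinePinsCriterionRatForms
import Summits.ABC.IUTFork.Joshi.TestGenuinePinsVacuityJoshiScope
import Summits.ABC.IUTFork.Cor312SettingDHVolWitness
import HarnessLib

/-!
# Branch E TEST — THE LINK PIN (pL) `Cor312Vol.LinkPinned` AT THE GENUINE CARRIER `settingPrVolSharp` (E-ROW R-65)

Proof-only file (abc-iut cell, D-0079 R-J «Joshi Y-discharge census», E-ROW R-65; seat abc-iut-E-t42, gen 9; 0 definitions, 0 instances, no
`Prop` fact, FACT rows used: none; everything BY NAME).  QUESTION: abc-iut-w5-d230's three-pin biconditional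
`exists_pinnedRegions3_settingPrVolSharp_iff_finrank_eq_one` (p504878) keeps the `ρ`-free link pin `hlink : Cor312Vol.LinkPinned … (settingPrVolSharp …)`
(:= abc-iut-c312-1's object-level `Thm311ToCor312.PilotLink`, `∃ e : Ob 𝒞⊩_lgp ≃ Ob 𝒞⊩_△, e (Θ-pilot) = q-pilot`) as a HYPOTHESIS — is it
DERIVABLE in the tree, REFUTABLE, or datum-dependent?  ANSWER (kernel): **DATUM-DEPENDENT, exact residual binder `Nonempty (Ob sig.Clgp ≃ ObΔ)`**.
* §1 (every `Cor312.Setting`): **`pilotLink_iff_nonempty_equiv`** `PilotLink P ↔ Nonempty (P.Ob P.sig.Clgp ≃ P.ObΔ)` — ANY bijection of the two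
  object types is corrected by one transposition (`Equiv.swap`) to carry the Θ-pilot to the q-pilot, so the typed (pL) reads ONLY the cardinalities
  `#Ob(𝒞⊩_lgp) = #Ob(𝒞⊩_△)` (`pilotLink_iff_cardinalMk_eq`), never the pilots; `not_pilotLink_of_subsingleton_of_nontrivial` (+ mirror); the three
  pins split (`pinnedRegions3_iff_pinnedRegions_and_nonempty_equiv`).
* §2 (abc-iut-c312-7's genuine carrier `Real.settingPrVolSharp`, any `hlog`, any column structure `col`): the context data `sig`/`split`/`qData` are
  CONTEXT ONLY there — both glue maps ignore the object (`thetaRegionOf_settingPrVolSharp_eq`, `qRegionOf_settingPrVolSharp_eq`: `rfl`), so (pL) is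
  decoupled from every region/volume pin; **`linkPinned_settingPrVolSharp_iff`** `… ↔ Nonempty (Ob sig.Clgp ≃ ObΔ)`.  DERIVABLE SIDE:
  `linkPinned_settingPrVolSharp_of_equiv`, and at abc-iut-c312-5's one-point context data `unitSigDH`/`unitSplitDH`/`unitQDataDH`
  **`linkPinned_settingPrVolSharp_unit`**.  REFUTABLE SIDE: `not_linkPinned_settingPrVolSharp_of_subsingleton_of_nontrivial`; concretely
  `unitSigDH`'s one-point `𝒞⊩_lgp` against ANY two-object `𝒞⊩_△` (`QPilotData Bool _`): **`not_linkPinned_settingPrVolSharp_unitSig_bool`**,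
  inhabited (`exists_qData_not_linkPinned_settingPrVolSharp`); both at once: **`linkPinned_settingPrVolSharp_datumDependent`**.
* §3 (the Y-26 frame of p503923/p504878): the three-pin word with the link hypothesis DISCHARGED INTO THE STATEMENT —
  **`exists_pinnedRegions3_settingPrVolSharp_iff_finrank_eq_one_and_nonempty_equiv`** `(∃ ρ qK, PinnedRegions3 …) ↔ [F:ℚ] = 1 ∧ Nonempty (Ob sig.Clgp ≃ ObΔ)`
  (non-zero Θ-ideles); p504878's `↔ [F:ℚ] = 1` from ANY bijection (`…_of_equiv`) and **HYPOTHESIS-FREE at the one-point context data**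
  (`exists_pinnedRegions3_settingPrVolSharp_unit_iff_finrank_eq_one`); `not_pinnedRegions3_settingPrVolSharp_of_isEmpty_equiv` (every `F`, even
  `F = ℚ`); the negative universal decided, `forall_not_pinnedRegions3_settingPrVolSharp_iff` `↔ 1 < [F:ℚ] ∨ IsEmpty (Ob sig.Clgp ≃ ObΔ)`; p514679's
  Joshi-scope classes are link-independent (`exists_pinnedRegions3_settingPrVolSharp_iff_false_of_isTotallyComplex`).

READING (tree currency; located, not adjudicated).  COUNT-NEUTRAL for Y-26/Y-31 (the two-pin word of record does not use (pL)): at OUR genuine carrier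
the typed link pin is a condition on the CONTEXT types alone, satisfied by the one-point context data every inhabited-side witness of record uses and
violated by a two-object `𝒞⊩_△`.  It says nothing about print's Θ×μ_LGP-link beyond what abc-iut-c312-1's object-level typing carries (Step (xii): the
full poly-isomorphism «only preserves isomorphism classes of objects»).  **No side is taken** on [IUTchIII] Cor. 3.12 / [IUTchIV] Thm. 1.10 or on any
author (Mochizuki / Scholze–Stix / Joshi / Dupuy–Hilado); typed ≠ proved; instantiated ≠ endorsed; NOT an abc claim. [claim: Mochizuki2012, status: disputed]
[cite: DupuyHilado2025, §3.9, §4.7, §4.9]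
-/

noncomputable section

open Set Function NumberField IsDedekindDomain Metric
open scoped Pointwise Classical

namespace Summit.ABC.IUTFork.Joshi

namespace GenuinePinsLinkPin

open Thm311 Thm311.Real Cor312 Cor312Vol Literature.IUT.LogThetaLattice Literature.IUT.LogVolume
  Literature.IUT.HodgeTheaters Literature.NumberTheory.NumberFields

/-! ## 1. Interface level: the object-level link pin reads only the cardinalities of the two object types -/

section Interface

variable {T : ThetaIndex} {S₀ : Situation T} (P : Cor312.Setting S₀)

/-- **ANY bijection `Ob 𝒞⊩_lgp ≃ Ob 𝒞⊩_△` pins the link**: correct it by the transposition exchanging the image of the Θ-pilot with the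
q-pilot. So abc-iut-c312-1's object-level (pL) does not read the pilots. [claim: Mochizuki2012, status: disputed] -/
theorem pilotLink_of_equiv (e : P.Ob P.sig.Clgp ≃ P.ObΔ) : Thm311ToCor312.PilotLink P :=
  ⟨e.trans (Equiv.swap (e P.thetaPilot) P.qPilot), by simp [Equiv.swap_apply_left]⟩

/-- **`PilotLink P ↔ Nonempty (P.Ob P.sig.Clgp ≃ P.ObΔ)`** — the exact content of the typed link pin. [claim: Mochizuki2012, status: disputed] -/
theorem pilotLink_iff_nonempty_equiv : Thm311ToCor312.PilotLink P ↔ Nonempty (P.Ob P.sig.Clgp ≃ P.ObΔ) :=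
  ⟨fun ⟨e, _⟩ => ⟨e⟩, fun ⟨e⟩ => pilotLink_of_equiv P e⟩

/-- … equivalently an equality of cardinals `#Ob(𝒞⊩_lgp) = #Ob(𝒞⊩_△)` (`Cardinal.eq`). [claim: Mochizuki2012, status: disputed] -/
theorem pilotLink_iff_cardinalMk_eq : Thm311ToCor312.PilotLink P ↔ Cardinal.mk (P.Ob P.sig.Clgp) = Cardinal.mk P.ObΔ :=
  (pilotLink_iff_nonempty_equiv P).trans Cardinal.eq.symm

/-- A one-object `𝒞⊩_lgp` cannot be linked to a `𝒞⊩_△` with two distinct objects. [folklore] -/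
theorem not_pilotLink_of_subsingleton_of_nontrivial [Subsingleton (P.Ob P.sig.Clgp)] [Nontrivial P.ObΔ] : ¬ Thm311ToCor312.PilotLink P :=
  fun ⟨e, _⟩ =>
  haveI : Subsingleton P.ObΔ := e.symm.subsingleton
  false_of_nontrivial_of_subsingleton P.ObΔ

/-- … nor a `𝒞⊩_lgp` with two distinct objects to a one-object `𝒞⊩_△`. [folklore] -/
theorem not_pilotLink_of_nontrivial_of_subsingleton [Nontrivial (P.Ob P.sig.Clgp)] [Subsingleton P.ObΔ] : ¬ Thm311ToCor312.PilotLink P :=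
  fun ⟨e, _⟩ =>
  haveI : Subsingleton (P.Ob P.sig.Clgp) := e.subsingleton
  false_of_nontrivial_of_subsingleton (P.Ob P.sig.Clgp)

variable (S : LatticeSituation T) (P : Cor312.Setting S.toSituation)
  (ρ : (∀ v : T.V, v ∈ T.Vbad → Set (S.L.StarPacket v)) → ∀ (j : T.Label) (vQ : T.VQ), Set (S.L.Packet j vQ))
  (qK : ∀ v : T.V, v ∈ T.Vbad → Set (S.L.StarPacket v))

/-- **`LinkPinned S P ↔ Nonempty (P.Ob P.sig.Clgp ≃ P.ObΔ)`** (abc-iut-w5-d230's (pL) is c312-1's `PilotLink`). [claim: Mochizuki2012, status: disputed] -/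
theorem linkPinned_iff_nonempty_equiv : LinkPinned S P ↔ Nonempty (P.Ob P.sig.Clgp ≃ P.ObΔ) :=
  pilotLink_iff_nonempty_equiv P

/-- **The three pins split**: `PinnedRegions3 ↔ PinnedRegions ∧ Nonempty (Ob 𝒞⊩_lgp ≃ Ob 𝒞⊩_△)` — the link pin is a conjunct on the
context types, independent of `ρ`, `qK`. [claim: Mochizuki2012, status: disputed] -/
theorem pinnedRegions3_iff_pinnedRegions_and_nonempty_equiv :
    PinnedRegions3 S P ρ qK ↔ PinnedRegions S P ρ qK ∧ Nonempty (P.Ob P.sig.Clgp ≃ P.ObΔ) :=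
  and_congr Iff.rfl (linkPinned_iff_nonempty_equiv S P)

end Interface

/-! ## 2. At the genuine carrier `settingPrVolSharp`: the link pin is a condition on the context types alone -/

section Carrier

variable {F : Type} [Field F] [NumberField F] (X : PilotData F) {logv : PadicLogs F} (hlog : LogvAnalytic logv)
  (M : Type) [Field M] [NumberField M]
  (archPk : ∀ (j : (thetaIndex X).Label) (vQ : (thetaIndex X).VQ), Set ((logShellsDH X logv).Packet j vQ))
  (archSub : ∀ (j : (thetaIndex X).Label) (v : (thetaIndex X).V),
    Set ((logShellsDH X logv).Packet j ((thetaIndex X).over v)))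
  (Ψ : ℤ → ∀ v : (thetaIndex X).V, v ∈ (thetaIndex X).Vbad → Set ((logShellsDH X logv).StarPacket v))
  (act : ℤ → ∀ v : (thetaIndex X).V, v ∈ (thetaIndex X).Vbad →
    (logShellsDH X logv).StarPacket v → Module.End ℚ ((logShellsDH X logv).StarPacket v))
  (Mmod : ℤ → ∀ j : (thetaIndex X).LabelStar, Set ((logShellsDH X logv).GlobalPacket j.1))
  (region : ℤ → ∀ j : (thetaIndex X).LabelStar, FinDivisor M → ∀ vQ : (thetaIndex X).VQ,
    Set ((logShellsDH X logv).Packet j.1 vQ))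
  (n : ℤ) {HT : Type} {LogLink : HT → HT → Type} {IsFull : ∀ {s t : HT}, LogLink s t → Prop}
  (lat : LGPGaussianLogThetaLattice LogLink IsFull)
  {Frd : Type} {IsoF : Frd → Frd → Type} {Ob : Frd → Type} {realify : Frd → Frd} {Strip : Type}
  {IsoS : Strip → Strip → Type} {Mv : ∀ v : (thetaIndex X).V, v ∈ (thetaIndex X).Vbad → Type}
  [∀ v h, Monoid (Mv v h)]
  (sig : GlobalLGPFrobenioidSignature (thetaIndex X).lstar (thetaIndex X).V (· ∈ (thetaIndex X).Vbad)
    Frd IsoF Ob realify Strip IsoS Mv)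
  (split : SplittingMonoids Mv) {ObΔ : Type} {N : ∀ v : (thetaIndex X).V, v ∈ (thetaIndex X).Vbad → Type}
  [∀ v h, Monoid (N v h)] (qData : QPilotData ObΔ N)
  (t : ∀ (pp : Nat.Primes) (_ : Fin X.lstar) (x : (thetaIndex X).Fibre (.inr pp)),
    haveI : Fact (pp : ℕ).Prime := ⟨pp.2⟩; kOf X pp.1 x)
  (tq : ∀ (pp : Nat.Primes) (x : (thetaIndex X).Fibre (.inr pp)), haveI : Fact (pp : ℕ).Prime := ⟨pp.2⟩; kOf X pp.1 x)
  (htq0 : ∀ pp x, tq pp x ≠ 0)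
  (htq1 : ∀ (pp : Nat.Primes) (x : (thetaIndex X).Fibre (.inr pp)),
    haveI : Fact (pp : ℕ).Prime := ⟨pp.2⟩; placeOf X pp.1 x ∉ X.S → ‖tq pp x‖ = 1)
  (col : ℤ → Column (logShellsDH X logv))

/-- At `settingPrVolSharp` the Θ-glue IGNORES the object of `𝒞⊩_lgp`: every object has the Θ-region `e⁻¹(ι_j(t_{Θ,j})·(R_I)^∼)` read off the
ideles `t` (Dupuy–Hilado sharp boxes). [cite: DupuyHilado2025, §3.7] [claim: Mochizuki2012, status: disputed] -/
theorem thetaRegionOf_settingPrVolSharp_eq (m : ℤ) (o o' : Ob sig.Clgp) :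
    (settingPrVolSharp X hlog M archPk archSub Ψ act Mmod region n lat sig split qData tq t htq0 htq1).thetaRegionOf m o =
      (settingPrVolSharp X hlog M archPk archSub Ψ act Mmod region n lat sig split qData tq t htq0 htq1).thetaRegionOf m o' :=
  rfl

/-- … and the q-glue IGNORES the object of `𝒞⊩_△` (q-region read off the ideles `tq`). [cite: DupuyHilado2025, §3.9] [claim: Mochizuki2012, status: disputed] -/
theorem qRegionOf_settingPrVolSharp_eq (o o' : ObΔ) :
    (settingPrVolSharp X hlog M archPk archSub Ψ act Mmod region n lat sig split qData tq t htq0 htq1).qRegionOf o =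
      (settingPrVolSharp X hlog M archPk archSub Ψ act Mmod region n lat sig split qData tq t htq0 htq1).qRegionOf o' :=
  rfl

/-- **THE RESIDUAL BINDER, `PilotLink` form** (no lattice structure needed). [claim: Mochizuki2012, status: disputed] -/
theorem pilotLink_settingPrVolSharp_iff :
    Thm311ToCor312.PilotLink (settingPrVolSharp X hlog M archPk archSub Ψ act Mmod region n lat sig split qData tq t htq0 htq1) ↔
      Nonempty (Ob sig.Clgp ≃ ObΔ) :=
  pilotLink_iff_nonempty_equiv _

/-- **THE RESIDUAL BINDER (E-ROW R-65)**: for every column structure `col` on abc-iut-c312-7's genuine carrier, `LinkPinned … (settingPrVolSharp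
… sig split qData …) ↔ Nonempty (Ob sig.Clgp ≃ ObΔ)` — neither derivable nor refutable uniformly in the context binders `sig`, `qData`; exactly
«the object types of `𝒞⊩_lgp` and `𝒞⊩_△` are equinumerous». [claim: Mochizuki2012, status: disputed] -/
theorem linkPinned_settingPrVolSharp_iff :
    LinkPinned ({ toSituation := situationPrVol X hlog M archPk archSub Ψ act Mmod region, col := col } : LatticeSituation (thetaIndex X))
        (settingPrVolSharp X hlog M archPk archSub Ψ act Mmod region n lat sig split qData tq t htq0 htq1) ↔
      Nonempty (Ob sig.Clgp ≃ ObΔ) :=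
  pilotLink_iff_nonempty_equiv _

/-- **DERIVABLE SIDE**: any bijection `Ob sig.Clgp ≃ ObΔ` pins the link at the genuine carrier. [claim: Mochizuki2012, status: disputed] -/
theorem linkPinned_settingPrVolSharp_of_equiv (e : Ob sig.Clgp ≃ ObΔ) :
    LinkPinned ({ toSituation := situationPrVol X hlog M archPk archSub Ψ act Mmod region, col := col } : LatticeSituation (thetaIndex X))
      (settingPrVolSharp X hlog M archPk archSub Ψ act Mmod region n lat sig split qData tq t htq0 htq1) :=
  pilotLink_of_equiv _ e

/-- **DERIVABLE at the one-point context data** `unitSigDH`/`unitSplitDH`/`unitQDataDH` of abc-iut-c312-5: both object types are `Unit`.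
[claim: Mochizuki2012, status: disputed] -/
theorem linkPinned_settingPrVolSharp_unit :
    LinkPinned ({ toSituation := situationPrVol X hlog M archPk archSub Ψ act Mmod region, col := col } : LatticeSituation (thetaIndex X))
      (settingPrVolSharp X hlog M archPk archSub Ψ act Mmod region n lat (unitSigDH X) (unitSplitDH X) (unitQDataDH X) tq t htq0
        htq1) :=
  pilotLink_of_equiv _ (Equiv.refl Unit)

/-- **REFUTABLE SIDE**: a one-object `𝒞⊩_lgp` and a `𝒞⊩_△` with two distinct objects carry NO link pin at the genuine carrier, whatever the
ideles, volumes, regions (the mirror case is symmetric: `not_pilotLink_of_nontrivial_of_subsingleton`). [claim: Mochizuki2012, status: disputed] -/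
theorem not_linkPinned_settingPrVolSharp_of_subsingleton_of_nontrivial [Subsingleton (Ob sig.Clgp)] [Nontrivial ObΔ] :
    ¬ LinkPinned ({ toSituation := situationPrVol X hlog M archPk archSub Ψ act Mmod region, col := col } :
        LatticeSituation (thetaIndex X))
      (settingPrVolSharp X hlog M archPk archSub Ψ act Mmod region n lat sig split qData tq t htq0 htq1) := by
  rw [linkPinned_settingPrVolSharp_iff]
  rintro ⟨e⟩
  haveI : Subsingleton ObΔ := e.symm.subsingleton
  exact false_of_nontrivial_of_subsingleton ObΔ

/-- **COUNTERMODEL CLASS**: abc-iut-c312-5's one-point `𝒞⊩_lgp` (`unitSigDH`) against ANY q-pilot datum valued in a TWO-object `𝒞⊩_△`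
(`ObΔ := Bool`, one-point splitting monoids): the link pin FAILS at the genuine carrier. [claim: Mochizuki2012, status: disputed] -/
theorem not_linkPinned_settingPrVolSharp_unitSig_bool
    (qData₂ : QPilotData Bool (fun (v : (thetaIndex X).V) (_ : v ∈ (thetaIndex X).Vbad) => Unit)) :
    ¬ LinkPinned ({ toSituation := situationPrVol X hlog M archPk archSub Ψ act Mmod region, col := col } :
        LatticeSituation (thetaIndex X))
      (settingPrVolSharp X hlog M archPk archSub Ψ act Mmod region n lat (unitSigDH X) (unitSplitDH X) qData₂ tq t htq0 htq1) := by
  rw [linkPinned_settingPrVolSharp_iff]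
  rintro ⟨e⟩
  exact Bool.false_ne_true (e.symm.injective (Subsingleton.elim (α := Unit) _ _))

/-- … and such a q-pilot datum exists (`q_v := ()`, object `true`): the countermodel class is INHABITED. [claim: Mochizuki2012, status: disputed] -/
theorem exists_qData_not_linkPinned_settingPrVolSharp :
    ∃ qData₂ : QPilotData Bool (fun (v : (thetaIndex X).V) (_ : v ∈ (thetaIndex X).Vbad) => Unit),
      ¬ LinkPinned ({ toSituation := situationPrVol X hlog M archPk archSub Ψ act Mmod region, col := col } :
          LatticeSituation (thetaIndex X))
        (settingPrVolSharp X hlog M archPk archSub Ψ act Mmod region n lat (unitSigDH X) (unitSplitDH X) qData₂ tq t htq0 htq1) :=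
  ⟨{ q := fun _ _ => (), q_gen := fun _ _ => Cor312.Checks.unit_isGenerator _, objOf := fun _ => true },
    not_linkPinned_settingPrVolSharp_unitSig_bool X hlog M archPk archSub Ψ act Mmod region n lat t tq htq0 htq1 col _⟩

/-- **BOTH SIDES AT ONCE** (one-point `𝒞⊩_lgp`): the link pin HOLDS for the one-point `𝒞⊩_△` and FAILS for a two-object `𝒞⊩_△` — same ideles,
regions, volumes. [claim: Mochizuki2012, status: disputed] -/
theorem linkPinned_settingPrVolSharp_datumDependent :
    LinkPinned ({ toSituation := situationPrVol X hlog M archPk archSub Ψ act Mmod region, col := col } : LatticeSituation (thetaIndex X))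
        (settingPrVolSharp X hlog M archPk archSub Ψ act Mmod region n lat (unitSigDH X) (unitSplitDH X) (unitQDataDH X) tq t htq0
          htq1) ∧
      ∃ qData₂ : QPilotData Bool (fun (v : (thetaIndex X).V) (_ : v ∈ (thetaIndex X).Vbad) => Unit),
        ¬ LinkPinned ({ toSituation := situationPrVol X hlog M archPk archSub Ψ act Mmod region, col := col } :
            LatticeSituation (thetaIndex X))
          (settingPrVolSharp X hlog M archPk archSub Ψ act Mmod region n lat (unitSigDH X) (unitSplitDH X) qData₂ tq t htq0 htq1) :=
  ⟨linkPinned_settingPrVolSharp_unit X hlog M archPk archSub Ψ act Mmod region n lat t tq htq0 htq1 col,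
    exists_qData_not_linkPinned_settingPrVolSharp X hlog M archPk archSub Ψ act Mmod region n lat t tq htq0 htq1 col⟩

end Carrier

/-! ## 3. The Y-26 frame: the three-pin biconditional with the link hypothesis discharged into the statement -/

section ThreePins

variable {F : Type} [Field F] [NumberField F] (X : PilotData F)
  (M : Type) [Field M] [NumberField M]
  (archPk : ∀ (j : (thetaIndex X).Label) (vQ : (thetaIndex X).VQ), Set ((logShellsDH X (analyticLogv F)).Packet j vQ))
  (archSub : ∀ (j : (thetaIndex X).Label) (v : (thetaIndex X).V),
    Set ((logShellsDH X (analyticLogv F)).Packet j ((thetaIndex X).over v)))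
  (Ψ : ℤ → ∀ v : (thetaIndex X).V, v ∈ (thetaIndex X).Vbad → Set ((logShellsDH X (analyticLogv F)).StarPacket v))
  (act : ℤ → ∀ v : (thetaIndex X).V, v ∈ (thetaIndex X).Vbad →
    (logShellsDH X (analyticLogv F)).StarPacket v → Module.End ℚ ((logShellsDH X (analyticLogv F)).StarPacket v))
  (Mmod : ℤ → ∀ j : (thetaIndex X).LabelStar, Set ((logShellsDH X (analyticLogv F)).GlobalPacket j.1))
  (region : ℤ → ∀ j : (thetaIndex X).LabelStar, FinDivisor M → ∀ vQ : (thetaIndex X).VQ,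
    Set ((logShellsDH X (analyticLogv F)).Packet j.1 vQ))
  (frobAdm : ℤ → ℤ → ∀ (j : (thetaIndex X).Label) (vQ : (thetaIndex X).VQ),
    Set ((logShellsDH X (analyticLogv F)).Packet j vQ) → Prop)
  (frobLogvol : ℤ → ℤ → ∀ (j : (thetaIndex X).Label) (vQ : (thetaIndex X).VQ),
    Set ((logShellsDH X (analyticLogv F)).Packet j vQ) → ℝ)
  (frobΨ : ℤ → ℤ → ∀ v : (thetaIndex X).V, v ∈ (thetaIndex X).Vbad → Set ((logShellsDH X (analyticLogv F)).StarPacket v))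
  (frobMmod : ℤ → ℤ → ∀ j : (thetaIndex X).LabelStar, Set ((logShellsDH X (analyticLogv F)).GlobalPacket j.1))
  (unitImage : ℤ → ℤ → ℕ → ∀ (j : (thetaIndex X).Label) (vQ : (thetaIndex X).VQ),
    Set ((logShellsDH X (analyticLogv F)).Packet j vQ))
  (ballImage : ℤ → ℤ → ∀ (j : (thetaIndex X).Label) (vQ : (thetaIndex X).VQ),
    Set ((logShellsDH X (analyticLogv F)).Packet j vQ))
  (thetaDiv : ℤ → ℤ → LgpDivisor M (thetaIndex X).lstar)
  (n : ℤ) {HT : Type} {LogLink : HT → HT → Type} {IsFull : ∀ {s t : HT}, LogLink s t → Prop}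
  (lat : LGPGaussianLogThetaLattice LogLink IsFull)
  {Frd : Type} {IsoF : Frd → Frd → Type} {Ob : Frd → Type} {realify : Frd → Frd} {Strip : Type}
  {IsoS : Strip → Strip → Type} {Mv : ∀ v : (thetaIndex X).V, v ∈ (thetaIndex X).Vbad → Type}
  [∀ v h, Monoid (Mv v h)]
  (sig : GlobalLGPFrobenioidSignature (thetaIndex X).lstar (thetaIndex X).V (· ∈ (thetaIndex X).Vbad)
    Frd IsoF Ob realify Strip IsoS Mv)
  (split : SplittingMonoids Mv) {ObΔ : Type} {N : ∀ v : (thetaIndex X).V, v ∈ (thetaIndex X).Vbad → Type}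
  [∀ v h, Monoid (N v h)] (qData : QPilotData ObΔ N)
  (t : ∀ (pp : Nat.Primes) (_ : Fin X.lstar) (x : (thetaIndex X).Fibre (.inr pp)),
    haveI : Fact (pp : ℕ).Prime := ⟨pp.2⟩; kOf X pp.1 x)
  (tq : ∀ (pp : Nat.Primes) (x : (thetaIndex X).Fibre (.inr pp)), haveI : Fact (pp : ℕ).Prime := ⟨pp.2⟩; kOf X pp.1 x)
  (ht0 : ∀ pp i x, t pp i x ≠ 0)
  (htq0 : ∀ pp x, tq pp x ≠ 0)
  (htq1 : ∀ (pp : Nat.Primes) (x : (thetaIndex X).Fibre (.inr pp)),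
    haveI : Fact (pp : ℕ).Prime := ⟨pp.2⟩; placeOf X pp.1 x ∉ X.S → ‖tq pp x‖ = 1)

/-- The residual binder in the Y-26 frame of p503923/p504878. [claim: Mochizuki2012, status: disputed] -/
theorem linkPinned_settingPrVolSharp_ofShells_iff :
    LinkPinned
        (LatticeSituation.ofShells (logShellsDH X (analyticLogv F)) M archPk archSub
          (summandPiecesPr X (logvAnalytic_analyticLogv (F := F))).Adm
          (summandPiecesPr X (logvAnalytic_analyticLogv (F := F))).logvol Ψ act Mmod region frobAdm frobLogvol frobΨ frobMmod
          unitImage ballImage thetaDiv)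
        (settingPrVolSharp X (logvAnalytic_analyticLogv (F := F)) M archPk archSub Ψ act Mmod region n lat sig split qData tq t
          htq0 htq1) ↔
      Nonempty (Ob sig.Clgp ≃ ObΔ) :=
  pilotLink_iff_nonempty_equiv _

include ht0 in
/-- **THE THREE-PIN WORD WITH THE LINK HYPOTHESIS DISCHARGED INTO THE STATEMENT** (non-zero Θ-ideles): `(∃ ρ qK, PinnedRegions3 …) ↔
[F:ℚ] = 1 ∧ Nonempty (Ob sig.Clgp ≃ ObΔ)` — p503923's two-pin criterion (⟹ R-55 p503388, ⟸ abc-iut-E-t41 p463284) ∧ §1; no link hypothesis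
remains. [claim: Mochizuki2012, status: disputed] [cite: DupuyHilado2025, §4.9] -/
theorem exists_pinnedRegions3_settingPrVolSharp_iff_finrank_eq_one_and_nonempty_equiv :
    (∃ (ρ : (∀ v : (thetaIndex X).V, v ∈ (thetaIndex X).Vbad → Set ((logShellsDH X (analyticLogv F)).StarPacket v)) →
          ∀ (j : (thetaIndex X).Label) (vQ : (thetaIndex X).VQ), Set ((logShellsDH X (analyticLogv F)).Packet j vQ))
      (qK : ∀ v : (thetaIndex X).V, v ∈ (thetaIndex X).Vbad → Set ((logShellsDH X (analyticLogv F)).StarPacket v)),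
      Cor312Vol.PinnedRegions3
        (LatticeSituation.ofShells (logShellsDH X (analyticLogv F)) M archPk archSub
          (summandPiecesPr X (logvAnalytic_analyticLogv (F := F))).Adm
          (summandPiecesPr X (logvAnalytic_analyticLogv (F := F))).logvol Ψ act Mmod region frobAdm frobLogvol frobΨ frobMmod
          unitImage ballImage thetaDiv)
        (settingPrVolSharp X (logvAnalytic_analyticLogv (F := F)) M archPk archSub Ψ act Mmod region n lat sig split qData tq t
          htq0 htq1) ρ qK) ↔
      Module.finrank ℚ F = 1 ∧ Nonempty (Ob sig.Clgp ≃ ObΔ) := by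
  constructor
  · rintro ⟨ρ, qK, hpin, hL⟩
    exact ⟨(exists_pinnedRegions_settingPrVolSharp_iff_finrank_eq_one X M archPk archSub Ψ act Mmod region frobAdm frobLogvol frobΨ
        frobMmod unitImage ballImage thetaDiv n lat sig split qData t tq htq0 htq1 ht0).1 ⟨ρ, qK, hpin⟩,
      (linkPinned_settingPrVolSharp_ofShells_iff X M archPk archSub Ψ act Mmod region frobAdm frobLogvol frobΨ frobMmod unitImage
        ballImage thetaDiv n lat sig split qData t tq htq0 htq1).1 hL⟩
  · rintro ⟨hF, ⟨e⟩⟩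
    obtain ⟨ρ, qK, hpin⟩ := (exists_pinnedRegions_settingPrVolSharp_iff_finrank_eq_one X M archPk archSub Ψ act Mmod region frobAdm
      frobLogvol frobΨ frobMmod unitImage ballImage thetaDiv n lat sig split qData t tq htq0 htq1 ht0).2 hF
    exact ⟨ρ, qK, hpin, (linkPinned_settingPrVolSharp_ofShells_iff X M archPk archSub Ψ act Mmod region frobAdm frobLogvol frobΨ
      frobMmod unitImage ballImage thetaDiv n lat sig split qData t tq htq0 htq1).2 ⟨e⟩⟩

include ht0 in
/-- **p504878's biconditional from ANY bijection of the object types** (`hlink` := `pilotLink_of_equiv`). [claim: Mochizuki2012, status: disputed] -/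
theorem exists_pinnedRegions3_settingPrVolSharp_iff_finrank_eq_one_of_equiv (e : Ob sig.Clgp ≃ ObΔ) :
    (∃ (ρ : (∀ v : (thetaIndex X).V, v ∈ (thetaIndex X).Vbad → Set ((logShellsDH X (analyticLogv F)).StarPacket v)) →
          ∀ (j : (thetaIndex X).Label) (vQ : (thetaIndex X).VQ), Set ((logShellsDH X (analyticLogv F)).Packet j vQ))
      (qK : ∀ v : (thetaIndex X).V, v ∈ (thetaIndex X).Vbad → Set ((logShellsDH X (analyticLogv F)).StarPacket v)),
      Cor312Vol.PinnedRegions3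
        (LatticeSituation.ofShells (logShellsDH X (analyticLogv F)) M archPk archSub
          (summandPiecesPr X (logvAnalytic_analyticLogv (F := F))).Adm
          (summandPiecesPr X (logvAnalytic_analyticLogv (F := F))).logvol Ψ act Mmod region frobAdm frobLogvol frobΨ frobMmod
          unitImage ballImage thetaDiv)
        (settingPrVolSharp X (logvAnalytic_analyticLogv (F := F)) M archPk archSub Ψ act Mmod region n lat sig split qData tq t
          htq0 htq1) ρ qK) ↔
      Module.finrank ℚ F = 1 :=
  exists_pinnedRegions3_settingPrVolSharp_iff_finrank_eq_one X M archPk archSub Ψ act Mmod region frobAdm frobLogvol frobΨ frobMmod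
    unitImage ballImage thetaDiv n lat sig split qData t tq ht0 htq0 htq1 (pilotLink_of_equiv _ e)

include ht0 in
/-- **HYPOTHESIS-FREE three-pin biconditional at the one-point context data** `unitSigDH`/`unitSplitDH`/`unitQDataDH`:
`(∃ ρ qK, PinnedRegions3 …) ↔ [F:ℚ] = 1`. [claim: Mochizuki2012, status: disputed] [cite: DupuyHilado2025, §4.9] -/
theorem exists_pinnedRegions3_settingPrVolSharp_unit_iff_finrank_eq_one :
    (∃ (ρ : (∀ v : (thetaIndex X).V, v ∈ (thetaIndex X).Vbad → Set ((logShellsDH X (analyticLogv F)).StarPacket v)) →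
          ∀ (j : (thetaIndex X).Label) (vQ : (thetaIndex X).VQ), Set ((logShellsDH X (analyticLogv F)).Packet j vQ))
      (qK : ∀ v : (thetaIndex X).V, v ∈ (thetaIndex X).Vbad → Set ((logShellsDH X (analyticLogv F)).StarPacket v)),
      Cor312Vol.PinnedRegions3
        (LatticeSituation.ofShells (logShellsDH X (analyticLogv F)) M archPk archSub
          (summandPiecesPr X (logvAnalytic_analyticLogv (F := F))).Adm
          (summandPiecesPr X (logvAnalytic_analyticLogv (F := F))).logvol Ψ act Mmod region frobAdm frobLogvol frobΨ frobMmod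
          unitImage ballImage thetaDiv)
        (settingPrVolSharp X (logvAnalytic_analyticLogv (F := F)) M archPk archSub Ψ act Mmod region n lat (unitSigDH X)
          (unitSplitDH X) (unitQDataDH X) tq t htq0 htq1) ρ qK) ↔
      Module.finrank ℚ F = 1 :=
  exists_pinnedRegions3_settingPrVolSharp_iff_finrank_eq_one_of_equiv X M archPk archSub Ψ act Mmod region frobAdm frobLogvol frobΨ
    frobMmod unitImage ballImage thetaDiv n lat (unitSigDH X) (unitSplitDH X) (unitQDataDH X) t tq ht0 htq0 htq1 (Equiv.refl Unit)

/-- **Without a bijection of the object types the three pins are KERNEL-EMPTY for EVERY `F`** — including `F = ℚ`, where the two pins are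
inhabited (abc-iut-E-t41 p463284); no hypothesis on the ideles. [claim: Mochizuki2012, status: disputed] -/
theorem not_pinnedRegions3_settingPrVolSharp_of_isEmpty_equiv (h : IsEmpty (Ob sig.Clgp ≃ ObΔ))
    (ρ : (∀ v : (thetaIndex X).V, v ∈ (thetaIndex X).Vbad → Set ((logShellsDH X (analyticLogv F)).StarPacket v)) →
      ∀ (j : (thetaIndex X).Label) (vQ : (thetaIndex X).VQ), Set ((logShellsDH X (analyticLogv F)).Packet j vQ))
    (qK : ∀ v : (thetaIndex X).V, v ∈ (thetaIndex X).Vbad → Set ((logShellsDH X (analyticLogv F)).StarPacket v)) :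
    ¬ Cor312Vol.PinnedRegions3
        (LatticeSituation.ofShells (logShellsDH X (analyticLogv F)) M archPk archSub
          (summandPiecesPr X (logvAnalytic_analyticLogv (F := F))).Adm
          (summandPiecesPr X (logvAnalytic_analyticLogv (F := F))).logvol Ψ act Mmod region frobAdm frobLogvol frobΨ frobMmod
          unitImage ballImage thetaDiv)
        (settingPrVolSharp X (logvAnalytic_analyticLogv (F := F)) M archPk archSub Ψ act Mmod region n lat sig split qData tq t
          htq0 htq1) ρ qK := fun hpin =>
  h.false ((pilotLink_iff_nonempty_equiv _).1 hpin.2).some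

include ht0 in
/-- **The negative universal, decided**: `(∀ ρ qK, ¬ PinnedRegions3 …) ↔ 1 < [F:ℚ] ∨ IsEmpty (Ob sig.Clgp ≃ ObΔ)` (non-zero Θ-ideles).
[claim: Mochizuki2012, status: disputed] -/
theorem forall_not_pinnedRegions3_settingPrVolSharp_iff :
    (∀ (ρ : (∀ v : (thetaIndex X).V, v ∈ (thetaIndex X).Vbad → Set ((logShellsDH X (analyticLogv F)).StarPacket v)) →
          ∀ (j : (thetaIndex X).Label) (vQ : (thetaIndex X).VQ), Set ((logShellsDH X (analyticLogv F)).Packet j vQ))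
      (qK : ∀ v : (thetaIndex X).V, v ∈ (thetaIndex X).Vbad → Set ((logShellsDH X (analyticLogv F)).StarPacket v)),
      ¬ Cor312Vol.PinnedRegions3
        (LatticeSituation.ofShells (logShellsDH X (analyticLogv F)) M archPk archSub
          (summandPiecesPr X (logvAnalytic_analyticLogv (F := F))).Adm
          (summandPiecesPr X (logvAnalytic_analyticLogv (F := F))).logvol Ψ act Mmod region frobAdm frobLogvol frobΨ frobMmod
          unitImage ballImage thetaDiv)
        (settingPrVolSharp X (logvAnalytic_analyticLogv (F := F)) M archPk archSub Ψ act Mmod region n lat sig split qData tq t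
          htq0 htq1) ρ qK) ↔
      1 < Module.finrank ℚ F ∨ IsEmpty (Ob sig.Clgp ≃ ObΔ) := by
  have h := (exists_pinnedRegions3_settingPrVolSharp_iff_finrank_eq_one_and_nonempty_equiv X M archPk archSub Ψ act Mmod region frobAdm
    frobLogvol frobΨ frobMmod unitImage ballImage thetaDiv n lat sig split qData t tq ht0 htq0 htq1).not
  simp only [not_exists, not_and_or, not_nonempty_iff] at h
  have hpos : 0 < Module.finrank ℚ F := Module.finrank_pos
  rw [h]
  exact or_congr_left ⟨fun _ => by omega, fun _ => by omega⟩

/-- **Joshi-scope classes are LINK-INDEPENDENT** (p514679 BY NAME): for `F` totally complex ([J-III] §3.1 (1)'s declared scope; every initial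
Θ-datum's `F ∋ √−1`) the three pins are KERNEL-EMPTY for EVERY context datum, link or no link: `(∃ ρ qK, PinnedRegions3 …) ↔ False`.
[cite: Joshi2024ATS3, §3.1 (1) p.27 l.11–12] [claim: Mochizuki2012, status: disputed] -/
theorem exists_pinnedRegions3_settingPrVolSharp_iff_false_of_isTotallyComplex [IsTotallyComplex F] :
    (∃ (ρ : (∀ v : (thetaIndex X).V, v ∈ (thetaIndex X).Vbad → Set ((logShellsDH X (analyticLogv F)).StarPacket v)) →
          ∀ (j : (thetaIndex X).Label) (vQ : (thetaIndex X).VQ), Set ((logShellsDH X (analyticLogv F)).Packet j vQ))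
      (qK : ∀ v : (thetaIndex X).V, v ∈ (thetaIndex X).Vbad → Set ((logShellsDH X (analyticLogv F)).StarPacket v)),
      Cor312Vol.PinnedRegions3
        (LatticeSituation.ofShells (logShellsDH X (analyticLogv F)) M archPk archSub
          (summandPiecesPr X (logvAnalytic_analyticLogv (F := F))).Adm
          (summandPiecesPr X (logvAnalytic_analyticLogv (F := F))).logvol Ψ act Mmod region frobAdm frobLogvol frobΨ frobMmod
          unitImage ballImage thetaDiv)
        (settingPrVolSharp X (logvAnalytic_analyticLogv (F := F)) M archPk archSub Ψ act Mmod region n lat sig split qData tq t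
          htq0 htq1) ρ qK) ↔
      False :=
  iff_false_intro fun ⟨ρ, qK, hpin⟩ =>
    not_pinnedRegions3_settingPrVolSharp_of_isTotallyComplex X M archPk archSub Ψ act Mmod region frobAdm frobLogvol frobΨ frobMmod
      unitImage ballImage thetaDiv n lat sig split qData t tq ρ qK htq0 htq1 hpin

end ThreePins

end GenuinePinsLinkPin

end Summit.ABC.IUTFork.Joshi

end
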